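import Summits.BirchSwinnertonDyer.Rank1Residual.O5.HeegnerLogTransportThreeChain
import HarnessLib
import HarnessLib.Audit.Tags

/-!
# Heegner-log transport at `p = 3` (KL3), part 3 of 3: the targets KL3-C / KL3-D / KL3-C♭ and the tower note KL3-E — o5-r2 GEN 16

Sibling of `O5/HeegnerLogTransportThree.lean` (part 1) and `O5/HeegnerLogTransportThreeChain.lean` (part 2); same source `HOME/b2b-bsdres-o5-r2/gen16/lean/HeegnerLogTransportThree.lean` v7, sha16 `38be72b6cc6441f0` (701 l.; o5-r2 GEN 16's FILE OF RECORD, HOME/INBOX.md l.13174),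
§3–§5 verbatim; split only for `lint.size`; typer of record cc-typer-5 GEN 17, docket cc-lead ⟦gen68⟧/⟦gen69⟧ (2′) (c31).  The module text of the source is in part 1
and applies here verbatim.  CITE-KEY REPAIRS for `lint.tags` (doc-only, inside the `[cite: …]` tags of the three node docstrings, locators
unchanged; DISCLOSED as in (c27a)): `BCS2024` ↦ `BurungaleCastellaSkinner2025` ×3 (= arXiv:2405.00270, A. Burungale–F. Castella–C. Skinner, *Base change and
Iwasawa Main Conjectures for GL₂*, IMRN 2025, doi:10.1093/imrn/rnaf082 — the source's '[BCS2024]') and `BDP2013` ↦ `BertoliniDarmonPrasanna2013`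
×2 (Duke Math. J. 162 (2013) — the source's '[BDP2013]'); nothing else differs from the source's §3–§5.

HONEST FRAMING: every node below is a `def … : Prop` — an OPEN statement / conjecture node (§3, §4, §4b) tagged `@[conjecture]`, EVIDENCE-supported
by census C-KL3-V (o5-r2 GEN 16, `b2b-bsdres-o5-r2/gen16/kl3/`, pre-registered before the job id; CALIBRATION PASS) — EVIDENCE only, never a
Literature fact; NOTHING is asserted, nothing is booked, no RESIDUAL-MAP mark moves; O5 OPEN.  The two theorems
(`o5HeegnerUnitIndexThree_of_heegnerIndex`, `o5HeegnerUnitIndexFromCompanionThree_of_unitIndex`) are bookkeeping: the ladder T-O5-B ⇒ KL3-C ⇒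
KL3-C♭ is kernel-checked, so the KL3 target is a WEAKENING of T-O5-B and not a restatement of it.  `@[conjecture]` × 3; 0 Literature facts; no `sorry`.
-/


noncomputable section

open scoped Classical

open WeierstrassCurve Literature.NumberTheory.EllipticCurves
  Literature.NumberTheory.EllipticCurves.ModularForms
  Literature.NumberTheory.EllipticCurves.Rank1Residual
  Literature.NumberTheory.EllipticCurves.Rank1Residual.Typed

namespace Summit.BirchSwinnertonDyer.Rank1Residual.O5.HeegnerLogTransport

open Summit.BirchSwinnertonDyer.Rank1Residual.X11b (padicLogOrd embAt padicPointOf)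
open Summit.BirchSwinnertonDyer.Rank1Residual.X11b.LocalIndex (psi
  exists_addEquiv_valuation_psi_padicPointOf valuation_psi_zsmul_add)
open Literature.NumberTheory.EllipticCurves.Rank1Residual (Addv)
open Summit.BirchSwinnertonDyer.Rank1Residual.Additive.LocalLog (reductionPointCount_of_addv)
open Summit.BirchSwinnertonDyer.Rank1Residual.X11b.AcSelmer (selmerAcBase)
open IsDedekindDomain (HeightOneSpectrum)
open scoped NumberField

/-! ## §3 The KL3 target on the T-O5-B class: bit 1 of the LOWER half (open; a weakening of T-O5-B) -/

/-- **KL3-C `O5HeegnerUnitIndexThree` (OPEN statement; the output of the KL3 chain, EVIDENCE-supported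
by census C-KL3-V).** On the class of T-O5-B (`Addv W 3`, `v₃(j) ≥ 0`, `f₃ = 2`, `ρ̄_{E,3^n}` onto for
all `n`), for every Heegner datum as in `HeegnerIndexBSDAt W 3` with `P` of infinite order:
IF `Ш(E/K)[3^∞] = 0`, `3 ∤ ∏_q c_q(E/ℚ)` and `3 ∤ c_D`, THEN `3 ∤ [E(K) : ℤ P]` (in the census currency
`ord₃ index = 0`; junk `index = 0` excluded by Kolyvagin as in `HeegnerIndexBSDAt`). This is LITERALLY
the `Ш[3] = 0` slice of T-O5-B's identity (`o5HeegnerUnitIndexThree_of_heegnerIndex` below) — the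
first bit of its LOWER inequality `2·ord₃ index ≤ ord₃ #Ш + 2·ord₃(c ∏ c_q)`, which no Kolyvagin-side
argument reaches. KL3 ROUTE TO IT (memo §3): for Kodaira III* rows with a 3-primitive generator at a
prime above 3 and unit depletion factors, KL3-A + Selmer matching + `GoodHeegnerLogUnitThree` (§4) for a
prime-to-3 companion; in general the companion is a GL₂-type `A_g` (KL Thm. 3.9) and the §4 input is the
`p = 3` Heegner-point main conjecture lower inclusion (Wan's divisibility at 3 — OPEN in print).
Census test (C-KL3-V, registered): on processed (E, G, D) triples the unit bits agree (P-KL3-1).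
OPEN — [status: open]. [cite: GrossLMS1991, §1 Conj. 1.2 (p. 237)] [cite: KrizLi2019, Thm. 1.16]
[cite: BurungaleCastellaSkinner2025, p. 5 (the `p = 3` gap) and Thm. 4.2.1] -/
@[conjecture] def O5HeegnerUnitIndexThree : Prop :=
  ∀ (W : WeierstrassCurve ℚ) [W.IsElliptic] [W.IsGloballyMinimal],
    Addv W 3 → 0 ≤ padicValRat 3 W.j → Additive.CondExpTwo W 3 →
    (∀ n : ℕ, W.HasSurjectiveModNGaloisRep (3 ^ n : ℕ)) →
  ∀ {N : ℕ} [NeZero N] (D : ModularParametrizationData W N)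
    (K : Type) [Field K] [NumberField K], IsImaginaryQuadratic K → SatisfiesHeegnerHypothesis N K →
    NumberField.discr K < -4 →
  ∀ (H : HeegnerDatum N (NumberField.discr K)) (ι : K →+* ℂ) (P : (W.baseChange K).toAffine.Point),
    WeierstrassCurve.Affine.Point.map ι.toRatAlgHom P = heegnerPointComplex D H →
    ¬ IsOfFinAddOrder P →
    Nat.card (AddCommGroup.primaryComponent (W.baseChange K).sha 3) = 1 →
    ¬ 3 ∣ W.tamagawaProduct → padicValInt 3 D.maninConstant = 0 →
    padicValNat 3 (AddSubgroup.zmultiples P).index = 0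

/-- **KL3-C is a weakening of T-O5-B** (`O5HeegnerIndexThree → O5HeegnerUnitIndexThree`): in Gross's
identity `ord₃#Ш + 2 ord₃∏c_q + 2 ord₃ c_D = 2 ord₃ index` the three hypotheses kill the left side.
Bookkeeping only (ℕ/ℤ arithmetic); it records that the KL3 target is the `Ш[3] = 0` rung of T-O5-B and
not a restatement of it. [folklore] -/
theorem o5HeegnerUnitIndexThree_of_heegnerIndex (h : O5HeegnerIndexThree) : O5HeegnerUnitIndexThree := by
  intro W _ _ hadd hj hf hsurj N _ D K _ _ hK hH hdisc H ι P hP hfin hsha htam hman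
  have h3 : (3 : ℕ) ≠ 2 := by decide
  have hs1 : W.HasSurjectiveModNGaloisRep 3 := by simpa using hsurj 1
  have key := h W hadd hj hf hsurj h3 hs1 D K hK hH hdisc H ι P hP hfin
  rw [hsha, hman] at key
  have ht : padicValNat 3 W.tamagawaProduct = 0 := padicValNat.eq_zero_of_not_dvd htam
  rw [ht] at key
  simpa using key

/-! ## §4 The companion-side input at GOOD `p = 3` (open at `p = 3`; known for `p ≥ 5`) -/

/-- **KL3-D `GoodHeegnerLogUnitThree` (OPEN at `p = 3`; the companion-side input of the KL3 chain,
typed for ELLIPTIC companions — the chain in general needs its GL₂-type form).** For `G/ℚ` globally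
minimal with GOOD reduction at 3 (`3 ∤ N_G`) and `ρ̄_{G,3}` onto, a Heegner datum (`K` of discriminant
`< −4`, `3 ∤ d_K`, `ι₃ : K →+* ℚ₃`, so 3 splits), `P′` its Heegner point of infinite order: IF
`Ш(G/K)[3^∞] = 0`, `3 ∤ ∏ c_q(G)`, `3 ∤ c_{D′}`, and `G(K)` has a point `Q` which is 3-PRIMITIVE at `ι₃`
(`ord₃ log_{ω_G} Q + ord₃|G̃(𝔽_3)| − 1 = 0`: a generator of `G(ℚ₃) ⊗ ℤ₃`), THEN the normalised Heegner
logarithm is a 3-adic unit: `ord₃ log_{ω_G} P′ + ord₃|G̃(𝔽_3)| − 1 = 0`. Route in print: `Sel_{∅,0}(K,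
G[3]) = 0` (from the hypotheses, Poitou–Tate) ⇒ BDP value `L_3^{BDP}(g)(𝟙) ≢ 0` (lower inclusion of the
BDP / Heegner-point main conjecture) ⇒ the conclusion by the `p`-adic Waldspurger formula
`L_p^{BDP}(𝟙) ≐ ((1 − a_p + p)/p)²·log²_{ω} P′`. KNOWN for good `p ≥ 5` (Burungale–Castella–Skinner
2024 Thm. A/4.2.1 with W. Zhang / Castella–Wan inputs); at `p = 3` "the only missing ingredient is the
divisibility (1.1) established in [Wan15], which assumes `p > 3` only for a comparison of certain
automorphic periods" (BCS2024 p. 5) — the ONE named printed gap the KL3 chain imports. The depletion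
factors away from 3 are omitted here (imprimitive version: add `U_G = 0`, memo Q-KL3-a).
OPEN at `p = 3` — [status: open]. [cite: BurungaleCastellaSkinner2025, p. 5 and Thm. 4.2.1] [cite: BertoliniDarmonPrasanna2013, Thm. 5.13]
[cite: KrizLi2019, Rem. 1.18] -/
@[conjecture] def GoodHeegnerLogUnitThree : Prop :=
  ∀ (G : WeierstrassCurve ℚ) [G.IsElliptic] [G.IsGloballyMinimal],
    ¬ 3 ∣ G.conductorNorm ℤ → G.HasSurjectiveModNGaloisRep 3 →
  ∀ {N' : ℕ} [NeZero N'] (D' : ModularParametrizationData G N')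
    (K : Type) [Field K] [NumberField K], IsImaginaryQuadratic K → SatisfiesHeegnerHypothesis N' K →
    NumberField.discr K < -4 → ¬ ((3 : ℤ) ∣ NumberField.discr K) →
  ∀ (H' : HeegnerDatum N' (NumberField.discr K)) (ι : K →+* ℂ) (ι₃ : K →+* ℚ_[3])
    (P' : (G.baseChange K).toAffine.Point),
    WeierstrassCurve.Affine.Point.map ι.toRatAlgHom P' = heegnerPointComplex D' H' →
    ¬ IsOfFinAddOrder P' →
    Nat.card (AddCommGroup.primaryComponent (G.baseChange K).sha 3) = 1 →
    ¬ 3 ∣ G.tamagawaProduct → padicValInt 3 D'.maninConstant = 0 →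
    (∃ Q : (G.baseChange K).toAffine.Point, ¬ IsOfFinAddOrder Q ∧
      padicLogOrd G 3 ι₃ Q + padicValInt 3 (nsCount G 3) - 1 = 0) →
    padicLogOrd G 3 ι₃ P' + padicValInt 3 (nsCount G 3) - 1 = 0

/-! ## §4b The reach of the `m = 1` transport: KL3-C♭ (the chain's output, hypotheses explicit) -/

/-- **KL3-C♭ `O5HeegnerUnitIndexFromCompanionThree` (CONJECTURE node = the exact output of the KL3 chain,
memo §3 (i)–(vi), with every hypothesis the chain consumes made explicit).** For `W` as in T-O5-B
(additive (t′) at 3, surjective 3-adic tower) TOGETHER WITH a globally minimal elliptic `G/ℚ` GOOD at 3,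
congruent to `W` mod 3 off `3·N_W·N_G`, a common Heegner field `K` (`d_K < −4`, `3 ∤ d_K`, an embedding
`ι₃ : K →+* ℚ₃`), and the `W`-side vanishing hypotheses of the Poitou–Tate count (memo §3(iv)):
`Ш(W/K)[3] = 0`, Tamagawa and Manin 3-units, `U = 0` at every prime `ℓ ≠ 3` of `N_W N_G` for BOTH curves
(stronger than needed: primes of `M` need no depletion), `t = 0` (`W(ℚ₃)[3] = 0`, tree binder
`NoLocalThreeTorsionAt`), and `d_W = 0` (some point of infinite order has unit `ω`-logarithm at `ι₃`) —
THEN `3 ∤ [W(K) : ℤP]`. It is implied by `O5HeegnerUnitIndexThree` (hence by T-O5-B) by monotonicity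
(`…_of_unitIndex` below, proved); the KL3 chain derives it instead from KL3-A (`KrizLiUnitBitTransportThree`,
a theorem in print), the residual-Selmer matching (iii) and the COMPANION-side KL3-D
(`GoodHeegnerLogUnitThree`, open = Wan₃ for `G` ordinary; signed BDP main conjecture at 3 for `G`
supersingular). Census C-KL3-V cells E3/E6 (`gen16/kl3/KL3-RESULT.md`) enumerate exactly the Cremona
pairs meeting these hypotheses. OPEN — [status: open]. [cite: KrizLi2019, Thm. 1.16 and §1.6]
[cite: BurungaleCastellaSkinner2025, p. 5] [cite: GrossLMS1991, Conj. 1.2] -/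
@[conjecture] def O5HeegnerUnitIndexFromCompanionThree : Prop :=
  ∀ (W G : WeierstrassCurve ℚ) [W.IsElliptic] [W.IsGloballyMinimal] [G.IsElliptic] [G.IsGloballyMinimal],
    Addv W 3 → 0 ≤ padicValRat 3 W.j → Additive.CondExpTwo W 3 →
    (∀ n : ℕ, W.HasSurjectiveModNGaloisRep (3 ^ n : ℕ)) →
    ¬ ((3 : ℤ) ∣ G.conductorNorm ℤ) →
    (∀ ℓ : ℕ, ℓ.Prime → ¬ (ℓ ∣ 3 * W.conductorNorm ℤ * G.conductorNorm ℤ) →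
      ((W.LFunction ℓ : ℤ) : ZMod 3) = ((G.LFunction ℓ : ℤ) : ZMod 3)) →
    (∀ ℓ : ℕ, ℓ.Prime → ℓ ≠ 3 → (ℓ ∣ W.conductorNorm ℤ * G.conductorNorm ℤ) →
      ¬ ((3 : ℤ) ∣ nsCount W ℓ) ∧ ¬ ((3 : ℤ) ∣ nsCount G ℓ)) →
    NoLocalThreeTorsionAt W 3 →
  ∀ {N N' : ℕ} [NeZero N] [NeZero N'] (D : ModularParametrizationData W N)
    (_D' : ModularParametrizationData G N')
    (K : Type) [Field K] [NumberField K], IsImaginaryQuadratic K →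
    SatisfiesHeegnerHypothesis N K → SatisfiesHeegnerHypothesis N' K →
    NumberField.discr K < -4 → ¬ ((3 : ℤ) ∣ NumberField.discr K) →
  ∀ (H : HeegnerDatum N (NumberField.discr K)) (ι : K →+* ℂ) (ι₃ : K →+* ℚ_[3])
    (P : (W.baseChange K).toAffine.Point),
    WeierstrassCurve.Affine.Point.map ι.toRatAlgHom P = heegnerPointComplex D H →
    ¬ IsOfFinAddOrder P →
    Nat.card (AddCommGroup.primaryComponent (W.baseChange K).sha 3) = 1 →
    ¬ 3 ∣ W.tamagawaProduct → ¬ 3 ∣ G.tamagawaProduct → padicValInt 3 D.maninConstant = 0 →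
    (∃ Q : (W.baseChange K).toAffine.Point, ¬ IsOfFinAddOrder Q ∧ padicLogOrd W 3 ι₃ Q = 0) →
    padicValNat 3 (AddSubgroup.zmultiples P).index = 0

/-- **KL3-C♭ is a weakening of KL3-C** (more hypotheses, same conclusion): bookkeeping, so that the
ladder `O5HeegnerIndexThree → O5HeegnerUnitIndexThree → O5HeegnerUnitIndexFromCompanionThree` is
kernel-checked and the companion route attacks its lowest rung. [folklore] -/
theorem o5HeegnerUnitIndexFromCompanionThree_of_unitIndex (h : O5HeegnerUnitIndexThree) :
    O5HeegnerUnitIndexFromCompanionThree := by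
  intro W G _ _ _ _ hadd hj hf hsurj _hG3 _hcong _hU _ht N N' _ _ D _D' K _ _ hK hH _hH' hdisc _hd3 H ι _ι₃ P
    hP hfin hsha htam _htamG hman _hQ
  exact h W hadd hj hf hsurj D K hK hH hdisc H ι P hP hfin hsha htam hman

/-! ## §5 The conjectural extension along the anticyclotomic tower (research note; NOT typed)

KL3-E (CONJECTURE, o5-r2 GEN 16; the anticyclotomic twin of T13 `DepletedCongruenceLawThree`; recorded
here as prose because ring-class Heegner points are not yet tree objects — definition request D-KL3-1 in
the memo). Kriz–Li's congruence is stated for the Heegner point traced to `K` (trivial character). The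
same direct-integration proof is expected to give, for every ring-class character `χ` of conductor prime
to `3NN′` AND of 3-power conductor, the congruence of `χ`-parts
`u_W·log_{ω_W} P_W(χ) ≡ ± u_G·log_{ω_G} P_G(χ) (mod 3^m 𝒪)` with the SAME depletion set and NO new factor
at 3 for non-trivial 3-power conductor. Consequence: the anticyclotomic BDP-type (square-root) 3-adic
`L`-functions of `W` (additive at 3) and of its prime-to-3 companion agree mod 3 after depletion — an
anticyclotomic Greenberg–Vatsal transport at an ADDITIVE prime, free of multiplicity one, transporting
ALL layers of the unit bit and hence (with a BDP-type anticyclotomic main conjecture for the companion)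
more than bit 1 of T-O5-B. Falsifier: one ring-class Heegner pair of small conductor violating the unit-bit
transport (engine ask E-KL3-1 to cc-eng-5: Heegner points over ring class fields in PARI).
[cite: KrizLi2019, Thm. 3.9 and Rem. 1.19] [cite: BertoliniDarmonPrasanna2013, Thm. 5.13] -/

end Summit.BirchSwinnertonDyer.Rank1Residual.O5.HeegnerLogTransport

end
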